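import Literature.AlgebraicTopology.SingularHomology.LocalHomology
import Literature.AlgebraicTopology.SingularHomology.ExcisionMayerVietoris
import HarnessLib

/-!
# The top homology of spheres (Hatcher Cor. 2.14): `Hₙ(Sⁿ; M) ≅ M` for `n ≥ 1`

A. Hatcher, *Algebraic Topology*, CUP 2002, Cor. 2.14 (p. 114) with Prop. 2.7 (p. 109, `H₀` of a
path-connected space via the augmentation `ε`, p. 110) and the Mayer–Vietoris sequence (§2.2,
pp. 149–150), completing the computation begun in `…LocalHomology` (Part II there proves
`Hⱼ(ℝᵏ ∖ 0) = 0` for `j ≥ k ≥ 1`, `Hₘ(ℝᵐ⁺¹ ∖ 0) ≠ 0`, and `puncturedSuccIso :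
Hⱼ₊₁(ℝᵏ⁺¹ ∖ 0) ≅ Hⱼ(ℝᵏ ∖ 0)` for `j ≥ 1`) in the concrete singular chain model of
`…SingularChainsConcrete`, for the punctured plane `Literature.punctured 2 = ℝ² ∖ {0}`, then all
`ℝᵐ⁺¹ ∖ {0}`, then the unit spheres `Literature.unitSphere (n + 1) ⊆ EuclideanSpace ℝ (Fin (n + 1))`.
The vanishing half of Cor. 2.14 (`Hₖ(Sⁿ) = 0`, `k ≠ 0, n`) is `…ExcisionMayerVietorisProofs`
(`Literature.AlgebraicTopology.SingularHomology.isZero_singularHomology_sphere_holds`); this file proves the other half and discharges the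
named fact `Literature.AlgebraicTopology.SingularHomology.nonempty_singularHomology_sphere_iso` of `…ExcisionMayerVietoris`:

* linear maps out of homology: `Literature.AlgebraicTopology.SingularHomology.scHomologyDesc`, `Literature.AlgebraicTopology.SingularHomology.homologyDesc`/`homologyDesc'`
  (a functional vanishing on boundaries descends to `H`), `…_cls` computation rules;
* degrees `0` and `1`: `Δ⁰` is a point (`StdSimplex.eq_zero_dim`), `SingularSimplex.ofPoint_pt`,
  the augmentation `Literature.CChain.eps : C₀(X; M) → M` with `ε ∘ ∂ = 0` (`CChain.eps_bd`), paths as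
  `1`-simplices `SingularSimplex.ofPath γ` with `∂ (m γ) = m [y] - m [x]` (`bd_single_ofPath`);
* **`H₀` of path-connected subspaces at chain level** (Prop. 2.7): `exists_bd_eq_sub_single`
  (`z - (ε z)[p₀] ∈ ∂ C₁(P)` for `z ∈ C₀(P)`, `P` path-connected), `exists_bd_eq_of_eps_eq_zero`,
  `CChain.epsH` (`ε` on `H₀` of a subcomplex) and the bottom of Mayer–Vietoris:
  `homologyMap_mvSES_f_cls_eq_zero_iff` (`[z] ↦ 0 ∈ H₀(A) ⊕ H₀(B) ↔ ε z = 0` for path-connected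
  `A`, `B`);
* the plane (`namespace PuncturedTwo`, slit decomposition `ℝ² ∖ 0 = A ∪ B`, `A ∩ B = {v₀ ≠ 0}`):
  `PuncturedTwo.mvTwoDeltaEquiv` (`H₁(C(A) + C(B)) ≃ ker (H₀(A ∩ B) → H₀(A) ⊕ H₀(B))` by the
  connecting map `δ`, injective as `H₁(A) = H₁(B) = 0`, onto by exactness),
  `PuncturedTwo.mvTwoKerEquiv` (`ker ≃ M` by the half-plane count `epsPos` of `…LocalHomology`:
  injective by splitting a `0`-chain of `A ∩ B` into its parts in the two (path-connected)
  half-planes, surjective by the cycles `m [(1,0)] - m [(-1,0)]`), hence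
  **`homologyPuncturedTwoIso : H₁(ℝ² ∖ 0; M) ≅ M`** and
  **`homologyPuncturedIso : Hₘ(ℝᵐ⁺¹ ∖ 0; M) ≅ M`** (`m ≥ 1`, via `puncturedSuccIso`);
* **spheres** (Cor. 2.14, via the radial homotopy equivalence `sphereHomotopyEquivPunctured` and the
  comparison `csingularHomology.compIso` with Mathlib's singular homology):
  `csingularHomologyUnitSphereIso`/`singularHomologyUnitSphereIso : Hₙ(Sⁿ; M) ≅ M` (`n ≥ 1`) and
  the discharge **`nonempty_singularHomology_sphere_iso_holds R M :
  nonempty_singularHomology_sphere_iso R M`** (the fact is stated for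
  `Metric.sphere (0 : EuclideanSpace ℝ (Fin (n + 1))) 1 = unitSphere (n + 1)` and `ULift M`).

Everything is proved; the sphere statements carry `[cite: HatcherAT2002, Cor. 2.14]`, the rest is
[folklore]. (`S⁰` is excluded by the named fact, `n ≥ 1`.)

## References

* A. Hatcher, *Algebraic Topology*, CUP 2002, §2.1 Prop. 2.7, Cor. 2.14; §2.2 pp. 149–150.
-/

noncomputable section

-- as in `SingularChainsConcrete`: chains of the concrete complex are `Finsupp`s up to unfolding
set_option backward.isDefEq.respectTransparency false

open CategoryTheory Limits

universe u v w t

namespace Literature.AlgebraicTopology.SingularHomology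

/-! ### Linear maps out of homology -/

section Desc

variable {R : Type v} [CommRing R]
variable {S : ShortComplex (ModuleCat.{w} R)} {N : Type*} [AddCommGroup N] [Module R N]

/-- A linear map `φ : S.X₂ → N` vanishing on the image of `S.f` descends to `H(S) → N`
(the universal property of `H = ker g / im f`; Hatcher 2002, §2.1). [folklore] -/
def scHomologyDesc (φ : S.X₂ →ₗ[R] N) (hφ : φ ∘ₗ S.f.hom = 0) : S.homology →ₗ[R] N :=
  ((LinearMap.range S.moduleCatToCycles).liftQ (φ ∘ₗ (LinearMap.ker S.g.hom).subtype) (by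
      rintro _ ⟨w, rfl⟩
      exact DFunLike.congr_fun hφ w)) ∘ₗ
    S.moduleCatHomologyIso.hom.hom

/-- `scHomologyDesc φ [z] = φ z`. [folklore] -/
@[simp]
lemma scHomologyDesc_cls (φ : S.X₂ →ₗ[R] N) (hφ : φ ∘ₗ S.f.hom = 0) (z : S.X₂) (hz : S.g z = 0) :
    scHomologyDesc φ hφ (scHomologyCls z hz) = φ z := by
  rw [scHomologyDesc, LinearMap.comp_apply]
  erw [moduleCatHomologyIso_hom_scHomologyCls]
  rw [Submodule.liftQ_apply]
  rfl

variable {ι : Type t} {c : ComplexShape ι} {K : HomologicalComplex (ModuleCat.{w} R) c} {i : ι}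

/-- A linear map `φ : Kᵢ → N` vanishing on boundaries descends to `Hᵢ(K) → N`
(Hatcher 2002, §2.1). [folklore] -/
def homologyDesc (φ : K.X i →ₗ[R] N) (hφ : φ ∘ₗ (K.d (c.prev i) i).hom = 0) :
    K.homology i →ₗ[R] N :=
  scHomologyDesc (S := K.sc i) φ hφ

/-- `homologyDesc φ [z] = φ z`. [folklore] -/
@[simp]
lemma homologyDesc_cls (φ : K.X i →ₗ[R] N) (hφ : φ ∘ₗ (K.d (c.prev i) i).hom = 0) (z : K.X i)
    (hz : K.d i (c.next i) z = 0) : homologyDesc φ hφ (homologyCls z hz) = φ z :=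
  scHomologyDesc_cls (S := K.sc i) φ hφ z hz

/-- `homologyDesc` with the source degree of the incoming differential given explicitly. [folklore] -/
def homologyDesc' (j : ι) (hj : c.prev i = j) (φ : K.X i →ₗ[R] N) (hφ : φ ∘ₗ (K.d j i).hom = 0) :
    K.homology i →ₗ[R] N :=
  homologyDesc φ (by subst hj; exact hφ)

/-- `homologyDesc' φ [z] = φ z`. [folklore] -/
@[simp]
lemma homologyDesc'_cls (j : ι) (hj : c.prev i = j) (φ : K.X i →ₗ[R] N)
    (hφ : φ ∘ₗ (K.d j i).hom = 0) (z : K.X i) (hz : K.d i (c.next i) z = 0) :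
    homologyDesc' j hj φ hφ (homologyCls z hz) = φ z := by
  subst hj
  exact homologyDesc_cls φ hφ z hz

end Desc

/-! ### Singular `0`-simplices, the augmentation, paths as `1`-simplices -/

section ZeroOne

variable (R : Type v) [CommRing R] (M : Type v) [AddCommGroup M] [Module R M]
variable {X : Type u} [TopologicalSpace X]

open SingularSimplex

omit R M in
/-- The coordinate of a point of `Δ⁰` is `1`. [folklore] -/
@[simp]
lemma StdSimplex.zero_dim_apply (t : StdSimplex 0) (i : Fin 1) : t i = 1 := by
  obtain rfl : i = 0 := Fin.eq_zero i
  have ht := stdSimplex.sum_eq_one t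
  rwa [Fin.sum_univ_one] at ht

omit R M in
/-- `Δ⁰` is a point. [folklore] -/
lemma StdSimplex.eq_zero_dim (s t : StdSimplex 0) : s = t := by
  apply stdSimplex.ext
  funext i
  rw [StdSimplex.zero_dim_apply, StdSimplex.zero_dim_apply]

omit R M in
/-- A singular `0`-simplex is the `0`-simplex at its point. [folklore] -/
@[simp]
lemma SingularSimplex.ofPoint_pt (ρ : SingularSimplex X 0) : ofPoint ρ.pt = ρ := by
  apply toContinuousMap_injective
  ext t : 1
  rw [ofPoint, Equiv.apply_symm_apply, ContinuousMap.const_apply, pt,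
    StdSimplex.eq_zero_dim default t]

omit R M in
/-- The image of a singular `0`-simplex is its point. [folklore] -/
lemma SingularSimplex.range_eq_pt (ρ : SingularSimplex X 0) : ρ.range = {ρ.pt} := by
  rw [← range_ofPoint ρ.pt, ofPoint_pt]

omit R M in
/-- `ofPoint` is injective. [folklore] -/
lemma SingularSimplex.ofPoint_injective : Function.Injective (ofPoint : X → SingularSimplex X 0) :=
  fun x y h => by rw [← pt_ofPoint x, h, pt_ofPoint]

/-- A `0`-chain lies in `C₀(P)` iff the points of its simplices lie in `P`. [folklore] -/
lemma mem_chainsIn_zero_iff (P : Set X) (c : CChain M X 0) :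
    c ∈ chainsIn R M X P 0 ↔ ∀ ρ ∈ c.support, ρ.pt ∈ P := by
  rw [mem_chainsIn_iff]
  refine forall₂_congr fun ρ _ => ?_
  rw [SingularSimplex.range_eq_pt, Set.singleton_subset_iff]

/-- **The augmentation** `ε : C₀(X; M) → M`, `ε (∑ mᵢ [xᵢ]) = ∑ mᵢ` (Hatcher 2002, §2.1, p. 110). [folklore] -/
def CChain.eps : CChain M X 0 →ₗ[R] M :=
  Finsupp.lsum R fun _ => LinearMap.id

/-- `ε (m [x]) = m`. [folklore] -/
@[simp]
lemma CChain.eps_single (ρ : SingularSimplex X 0) (m : M) : CChain.eps R M (Finsupp.single ρ m) = m := by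
  rw [CChain.eps]
  erw [Finsupp.lsum_single]
  rfl

/-- `ε ∘ ∂ = 0` on elementary `1`-chains: `ε (m [τ∘δ₀] - m [τ∘δ₁]) = 0` (Hatcher 2002, §2.1, p. 110). [folklore] -/
lemma CChain.eps_bd_single (τ : SingularSimplex X 1) (m : M) :
    CChain.eps R M (csingularChainComplex.bd R 0 (Finsupp.single τ m)) = 0 := by
  rw [csingularChainComplex.bd_single, Fin.sum_univ_two, map_add]
  simp

/-- `ε ∘ ∂ = 0` (Hatcher 2002, §2.1, p. 110). [folklore] -/
lemma CChain.eps_comp_bd : CChain.eps R M ∘ₗ csingularChainComplex.bd R 0 = (0 : CChain M X 1 →ₗ[R] M) := by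
  refine Finsupp.lhom_ext fun τ m => ?_
  rw [LinearMap.comp_apply, CChain.eps_bd_single, LinearMap.zero_apply]

/-- `ε (∂ w) = 0`. [folklore] -/
@[simp]
lemma CChain.eps_bd (w : CChain M X 1) : CChain.eps R M (csingularChainComplex.bd R 0 w) = 0 := by
  rw [← LinearMap.comp_apply, CChain.eps_comp_bd, LinearMap.zero_apply]

omit R M in
/-- The projection `Δ¹ → [0, 1]`, `t ↦ t₁` (Mathlib's `stdSimplexEquivIcc` as a continuous map). [folklore] -/
def StdSimplex.toUnitInterval : C(StdSimplex 1, unitInterval) :=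
  ⟨fun t => ⟨t 1, stdSimplex.zero_le t 1, stdSimplex.le_one t 1⟩,
    ((continuous_apply 1).comp continuous_subtype_val).subtype_mk _⟩

omit R M in
/-- The value of `toUnitInterval`. [folklore] -/
@[simp]
lemma StdSimplex.coe_toUnitInterval (t : StdSimplex 1) : (StdSimplex.toUnitInterval t : ℝ) = t 1 :=
  rfl

/-- A path `γ` from `x` to `y` as a singular `1`-simplex `t ↦ γ(t₁)` (Hatcher 2002, §2.1,
Prop. 2.7: paths as singular `1`-simplices). [folklore] -/
def SingularSimplex.ofPath {x y : X} (γ : Path x y) : SingularSimplex X 1 :=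
  toContinuousMap.symm (γ.toContinuousMap.comp StdSimplex.toUnitInterval)

omit R M in
/-- The value of `ofPath γ`. [folklore] -/
lemma SingularSimplex.ofPath_apply {x y : X} (γ : Path x y) (t : StdSimplex 1) :
    toContinuousMap (ofPath γ) t = γ (StdSimplex.toUnitInterval t) := by
  rw [ofPath, Equiv.apply_symm_apply]
  rfl

omit R M in
/-- The image of `ofPath γ` is the image of `γ`. [folklore] -/
lemma SingularSimplex.range_ofPath_subset {x y : X} (γ : Path x y) :
    (ofPath γ).range ⊆ Set.range γ := by
  rintro _ ⟨t, rfl⟩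
  rw [ofPath_apply]
  exact ⟨_, rfl⟩

omit R M in
/-- The end point of `ofPath γ`: `(ofPath γ) ∘ δ₀ = [y]`. [folklore] -/
lemma SingularSimplex.ofPath_face_zero {x y : X} (γ : Path x y) : (ofPath γ).face 0 = ofPoint y := by
  apply toContinuousMap_injective
  ext t : 1
  rw [face_eq_compose, toContinuousMap_compose, ContinuousMap.comp_apply, StdSimplex.affMap_apply,
    ofPath_apply]
  have h1 : StdSimplex.toUnitInterval (StdSimplex.affComb (fun j => stdSimplex.vertex
      (Fin.succAbove (0 : Fin 2) j)) t) = 1 := by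
    apply Subtype.ext
    rw [StdSimplex.coe_toUnitInterval, StdSimplex.affComb_apply, Fin.sum_univ_one,
      StdSimplex.zero_dim_apply, one_mul]
    simp
  rw [h1, Path.target]
  rfl

omit R M in
/-- The starting point of `ofPath γ`: `(ofPath γ) ∘ δ₁ = [x]`. [folklore] -/
lemma SingularSimplex.ofPath_face_one {x y : X} (γ : Path x y) : (ofPath γ).face 1 = ofPoint x := by
  apply toContinuousMap_injective
  ext t : 1
  rw [face_eq_compose, toContinuousMap_compose, ContinuousMap.comp_apply, StdSimplex.affMap_apply,
    ofPath_apply]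
  have h0 : StdSimplex.toUnitInterval (StdSimplex.affComb (fun j => stdSimplex.vertex
      (Fin.succAbove (1 : Fin 2) j)) t) = 0 := by
    apply Subtype.ext
    rw [StdSimplex.coe_toUnitInterval, StdSimplex.affComb_apply, Fin.sum_univ_one,
      StdSimplex.zero_dim_apply, one_mul]
    simp
  rw [h0, Path.source]
  rfl

/-- `∂ (m • γ) = m [y] - m [x]` for a path `γ` from `x` to `y` (Hatcher 2002, §2.1). [folklore] -/
lemma bd_single_ofPath {x y : X} (γ : Path x y) (m : M) :
    csingularChainComplex.bd R 0 (Finsupp.single (ofPath γ) m) =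
      Finsupp.single (ofPoint y) m - Finsupp.single (ofPoint x) m := by
  rw [csingularChainComplex.bd_single, Fin.sum_univ_two, SingularSimplex.ofPath_face_zero,
    SingularSimplex.ofPath_face_one]
  simp [sub_eq_add_neg]

end ZeroOne

/-! ### `H₀` and path-connectedness; the bottom of the Mayer–Vietoris sequence -/

section HZero

variable (R : Type v) [CommRing R] (M : Type v) [AddCommGroup M] [Module R M]
variable {X : Type u} [TopologicalSpace X]

open SingularSimplex

/-- In a path-connected subspace `P ∋ p₀`, every `0`-chain `z` in `P` is homologous in `P` to
`(ε z) [p₀]`: `z - (ε z)[p₀] = ∂ w` with `w ∈ C₁(P)` (Hatcher 2002, Prop. 2.7). [folklore] -/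
lemma exists_bd_eq_sub_single {P : Set X} (hP : IsPathConnected P) {p₀ : X} (hp₀ : p₀ ∈ P)
    (z : CChain M X 0) (hz : z ∈ chainsIn R M X P 0) :
    ∃ w ∈ chainsIn R M X P 1, csingularChainComplex.bd R 0 w =
      z - Finsupp.single (ofPoint p₀) (CChain.eps R M z) := by
  revert hz
  refine Finsupp.induction z ?_ ?_
  · intro
    exact ⟨0, Submodule.zero_mem _, by simp⟩
  · intro ρ m f hρ hm ih hz
    classical
    rw [mem_chainsIn_zero_iff] at hz
    have hfρ : f ρ = 0 := Finsupp.notMem_support_iff.mp hρ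
    have hρP : ρ.pt ∈ P := hz ρ (by
      rw [Finsupp.mem_support_iff, Finsupp.add_apply, Finsupp.single_eq_same, hfρ, add_zero]
      exact hm)
    have hf : f ∈ chainsIn R M X P 0 := by
      rw [mem_chainsIn_zero_iff]
      intro σ hσ
      refine hz σ ?_
      have hσρ : ρ ≠ σ := fun h => hρ (h ▸ hσ)
      rw [Finsupp.mem_support_iff, Finsupp.add_apply, Finsupp.single_apply, if_neg hσρ, zero_add]
      exact Finsupp.mem_support_iff.mp hσ
    obtain ⟨w, hw, hbd⟩ := ih hf
    have hJ : JoinedIn P p₀ ρ.pt := hP.joinedIn p₀ hp₀ ρ.pt hρP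
    have hγ : (ofPath hJ.somePath).range ⊆ P :=
      (range_ofPath_subset hJ.somePath).trans (by rintro _ ⟨t, rfl⟩; exact hJ.somePath_mem t)
    refine ⟨Finsupp.single (ofPath hJ.somePath) m + w,
      Submodule.add_mem _ (single_mem_chainsIn R M hγ m) hw, ?_⟩
    rw [map_add, hbd, bd_single_ofPath, ofPoint_pt, map_add, CChain.eps_single, Finsupp.single_add]
    abel

/-- In a path-connected subspace, a `0`-chain with `ε = 0` is a boundary of a `1`-chain in the
subspace (Hatcher 2002, Prop. 2.7: `H₀` of a path-connected space). [folklore] -/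
lemma exists_bd_eq_of_eps_eq_zero {P : Set X} (hP : IsPathConnected P) {z : CChain M X 0}
    (hz : z ∈ chainsIn R M X P 0) (hε : CChain.eps R M z = 0) :
    ∃ w ∈ chainsIn R M X P 1, csingularChainComplex.bd R 0 w = z := by
  obtain ⟨p₀, hp₀⟩ := hP.nonempty
  obtain ⟨w, hw, hbd⟩ := exists_bd_eq_sub_single R M hP hp₀ z hz
  refine ⟨w, hw, ?_⟩
  rw [hbd, hε, Finsupp.single_zero, sub_zero]

/-- The augmentation on `H₀` of a subcomplex of singular chains: `[z] ↦ ε z`. [folklore] -/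
def CChain.epsH (U : Subcomplex (csingularChainComplex R M X)) : U.toComplex.homology 0 →ₗ[R] M :=
  homologyDesc' (K := U.toComplex) (i := 0) 1 (ChainComplex.prev ℕ 0) (CChain.eps R M ∘ₗ (U 0).subtype) (by
    refine LinearMap.ext fun w => ?_
    change CChain.eps R M (U.toComplex.d 1 0 w).1 = 0
    rw [toComplex_d_val, CChain.eps_bd])

/-- `epsH [z] = ε z`. [folklore] -/
@[simp]
lemma CChain.epsH_cls (U : Subcomplex (csingularChainComplex R M X)) (z : U.toComplex.X 0)
    (hz : U.toComplex.d 0 ((ComplexShape.down ℕ).next 0) z = 0) :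
    CChain.epsH R M U (homologyCls z hz) = CChain.eps R M z.1 :=
  homologyDesc'_cls (K := U.toComplex) (i := 0) 1 (ChainComplex.prev ℕ 0) _ _ z hz

/-- A `0`-cycle of a subcomplex `U ≤ C(P)` whose class dies in `H₀(C(P))` has `ε = 0`. [folklore] -/
lemma eps_eq_zero_of_homologyMap_incl_eq_zero {U : Subcomplex (csingularChainComplex R M X)}
    {P : Set X} (hU : U ≤ chainsInSub R M X P) (z : U.toComplex.X 0)
    (hz : U.toComplex.d 0 ((ComplexShape.down ℕ).next 0) z = 0)
    (h0 : HomologicalComplex.homologyMap (Subcomplex.incl hU) 0 (homologyCls z hz) = 0) :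
    CChain.eps R M z.1 = 0 := by
  rw [homologyMap_homologyCls, homologyCls_eq_zero_iff,
    exists_d_prev_eq_iff (ChainComplex.prev ℕ 0)] at h0
  obtain ⟨w, hw⟩ := h0
  have h := congrArg Subtype.val hw
  rw [toComplex_d_val] at h
  change csingularChainComplex.bd R 0 (w.1 : CChain M X 1) = z.1 at h
  rw [← h, CChain.eps_bd]

/-- Conversely, for path-connected `P`, a `0`-cycle of `U ≤ C(P)` with `ε = 0` dies in `H₀(C(P))`. [folklore] -/
lemma homologyMap_incl_eq_zero_of_eps_eq_zero {U : Subcomplex (csingularChainComplex R M X)}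
    {P : Set X} (hP : IsPathConnected P) (hU : U ≤ chainsInSub R M X P) (z : U.toComplex.X 0)
    (hz : U.toComplex.d 0 ((ComplexShape.down ℕ).next 0) z = 0) (hε : CChain.eps R M z.1 = 0) :
    HomologicalComplex.homologyMap (Subcomplex.incl hU) 0 (homologyCls z hz) = 0 := by
  have hzP : (z.1 : CChain M X 0) ∈ chainsIn R M X P 0 := (mem_chainsInSub_iff R M P 0 _).mp (hU 0 z.2)
  obtain ⟨w, hw, hbd⟩ := exists_bd_eq_of_eps_eq_zero R M hP hzP hε
  rw [homologyMap_homologyCls, homologyCls_eq_zero_iff, exists_d_prev_eq_iff (ChainComplex.prev ℕ 0)]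
  refine ⟨⟨w, (mem_chainsInSub_iff R M P 1 _).mpr hw⟩, Subtype.ext ?_⟩
  rw [toComplex_d_val]
  exact hbd

end HZero

/-! ### The bottom of the Mayer–Vietoris sequence: the kernel of `H₀(A ∩ B) → H₀(A) ⊕ H₀(B)` -/

section MVBottom

variable (R : Type v) [CommRing R] (M : Type v) [AddCommGroup M] [Module R M]
variable {X : Type u} [TopologicalSpace X] {A B : Set X}

open SingularSimplex

/-- For path-connected `A`, `B`: a class `[z] ∈ H₀(C(A ∩ B))` dies in `H₀(C(A)) ⊕ H₀(C(B))` iff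
`ε z = 0` (Hatcher 2002, §2.2, the end of the Mayer–Vietoris sequence). [folklore] -/
lemma homologyMap_mvSES_f_cls_eq_zero_iff (hA : IsPathConnected A) (hB : IsPathConnected B)
    (z : (mvSES R M X A B).X₁.X 0)
    (hz : (mvSES R M X A B).X₁.d 0 ((ComplexShape.down ℕ).next 0) z = 0) :
    HomologicalComplex.homologyMap (mvSES R M X A B).f 0 (homologyCls z hz) = 0 ↔
      CChain.eps R M z.1 = 0 := by
  change HomologicalComplex.homologyMap (Subcomplex.mvSubF _ _) 0 _ = 0 ↔ _
  rw [homologyMap_lift_eq_zero_iff]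
  constructor
  · rintro ⟨h, -⟩
    exact eps_eq_zero_of_homologyMap_incl_eq_zero R M inf_le_left z hz h
  · intro hε
    exact ⟨homologyMap_incl_eq_zero_of_eps_eq_zero R M hA inf_le_left z hz hε,
      homologyMap_incl_eq_zero_of_eps_eq_zero R M hB inf_le_right z hz hε⟩

/-- One direction needs no connectedness: a class of `H₀(C(A ∩ B))` dying in
`H₀(C(A)) ⊕ H₀(C(B))` has `ε = 0`. [folklore] -/
lemma eps_eq_zero_of_homologyMap_mvSES_f_eq_zero (z : (mvSES R M X A B).X₁.X 0)
    (hz : (mvSES R M X A B).X₁.d 0 ((ComplexShape.down ℕ).next 0) z = 0)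
    (h : HomologicalComplex.homologyMap (mvSES R M X A B).f 0 (homologyCls z hz) = 0) :
    CChain.eps R M z.1 = 0 := by
  change HomologicalComplex.homologyMap (Subcomplex.mvSubF _ _) 0 _ = 0 at h
  rw [homologyMap_lift_eq_zero_iff] at h
  exact eps_eq_zero_of_homologyMap_incl_eq_zero R M inf_le_left z hz h.1

end MVBottom

/-! ### `H₁(ℝ² ∖ 0; M) ≅ M` -/

section PuncturedTwo

variable (R : Type v) [CommRing R] (M : Type v) [AddCommGroup M] [Module R M]

open SingularSimplex

/-- The slit pieces of `ℝᵏ⁺¹ ∖ 0` are path-connected (they are star-shaped). [folklore] -/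
lemma isPathConnected_slitUp (k : ℕ) : IsPathConnected (slitUp k) := by
  haveI := contractibleSpace_slitUp k
  exact isPathConnected_iff_pathConnectedSpace.mpr inferInstance

/-- The slit pieces of `ℝᵏ⁺¹ ∖ 0` are path-connected (they are star-shaped). [folklore] -/
lemma isPathConnected_slitDown (k : ℕ) : IsPathConnected (slitDown k) := by
  haveI := contractibleSpace_slitDown k
  exact isPathConnected_iff_pathConnectedSpace.mpr inferInstance

omit R M in
/-- `A ∩ B = {v₀ ≠ 0}` for the slit decomposition of `ℝ² ∖ {0}`. [folklore] -/
lemma slitInter_one_eq : slitUp 1 ∩ slitDown 1 = {v : RVec 2 | v 0 ≠ 0} := by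
  rw [slitUp_inter_slitDown]
  ext v
  exact init_ne_zero_iff v

namespace PuncturedTwo

/-- The Mayer–Vietoris sequence of the slit decomposition of `ℝ² ∖ {0}`. [folklore] -/
abbrev mvTwo := mvSES R M (RVec 2) (slitUp 1) (slitDown 1)

/-- The chains of the first term `C(A ∩ B)` of `mvTwo` avoid the vertical axis. [folklore] -/
lemma mvTwo_X₁_mem {j : ℕ} (w : (mvTwo R M).X₁.X j) :
    (w.1 : CChain M (RVec 2) j) ∈ chainsIn R M (RVec 2) {v | v 0 ≠ 0} j := by
  have hw := (mem_chainsInSub_iff R M _ j _).mp ((chainsInSub_inter R M (slitUp 1) (slitDown 1)).symm.le j w.2)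
  exact chainsIn_mono R M slitInter_one_subset j hw

/-- The half-plane count `epsPos` on `H₀(C(A ∩ B))`: `[z] ↦ epsPos z`. [folklore] -/
def epsPosH : (mvTwo R M).X₁.homology 0 →ₗ[R] M :=
  homologyDesc' (K := (mvTwo R M).X₁) (i := 0) 1 (ChainComplex.prev ℕ 0)
    (epsPos R M ∘ₗ ((chainsInSub R M (RVec 2) (slitUp 1) ⊓ chainsInSub R M (RVec 2) (slitDown 1)) 0).subtype) (by
      refine LinearMap.ext fun w => ?_
      change epsPos R M ((mvTwo R M).X₁.d 1 0 w).1 = 0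
      rw [show ((mvTwo R M).X₁.d 1 0 w).1 = csingularChainComplex.bd R 0 (w.1 : CChain M (RVec 2) 1)
        from toComplex_d_val R M _ 0 w]
      exact epsPos_bd R M (mvTwo_X₁_mem R M w))

/-- `epsPosH [z] = epsPos z`. [folklore] -/
@[simp]
lemma epsPosH_cls (z : (mvTwo R M).X₁.X 0) (hz : (mvTwo R M).X₁.d 0 ((ComplexShape.down ℕ).next 0) z = 0) :
    epsPosH R M (homologyCls z hz) = epsPos R M z.1 :=
  homologyDesc'_cls (K := (mvTwo R M).X₁) (i := 0) 1 (ChainComplex.prev ℕ 0) _ _ z hz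

/-- The kernel of `H₀(C(A ∩ B)) → H₀(C(A)) ⊕ H₀(C(B))` for `ℝ² ∖ {0}`. [folklore] -/
def mvTwoKer : Submodule R ((mvTwo R M).X₁.homology 0) :=
  LinearMap.ker (HomologicalComplex.homologyMap (mvTwo R M).f 0).hom

/-- Membership in the kernel: `[z] ∈ ker ↔ ε z = 0`. [folklore] -/
lemma cls_mem_mvTwoKer_iff (z : (mvTwo R M).X₁.X 0)
    (hz : (mvTwo R M).X₁.d 0 ((ComplexShape.down ℕ).next 0) z = 0) :
    homologyCls z hz ∈ mvTwoKer R M ↔ CChain.eps R M z.1 = 0 :=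
  homologyMap_mvSES_f_cls_eq_zero_iff R M (isPathConnected_slitUp 1) (isPathConnected_slitDown 1) z hz

/-- `H₁` of `A`, `B` vanishes, so the middle term `H₁(X₂)` of `mvTwo` vanishes. [folklore] -/
lemma isZero_mvTwo_X₂_homology_one : IsZero ((mvTwo R M).X₂.homology 1) :=
  isZero_mvX₂_homology R M _ _ 1 (isZero_homology_slitUp R M 1 one_ne_zero)
    (isZero_homology_slitDown R M 1 one_ne_zero)

/-- The connecting map `δ : H₁(X₃) → H₀(C(A ∩ B))` of `mvTwo` lands in the kernel and is a linear
equivalence onto it (`δ` is injective as `H₁(A) ⊕ H₁(B) = 0`, and exactness). [folklore] -/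
def mvTwoDeltaEquiv : (mvTwo R M).X₃.homology 1 ≃ₗ[R] mvTwoKer R M :=
  LinearEquiv.ofBijective
    (LinearMap.codRestrict (mvTwoKer R M) ((mvSES_shortExact R M (slitUp 1) (slitDown 1)).δ 1 0 rfl).hom
      fun y => by
        change HomologicalComplex.homologyMap (mvTwo R M).f 0 (((mvSES_shortExact R M _ _).δ 1 0 rfl) y) = 0
        rw [← ModuleCat.comp_apply, (mvSES_shortExact R M (slitUp 1) (slitDown 1)).δ_comp 1 0 rfl]
        rfl)
    ⟨fun y y' h => (ModuleCat.mono_iff_injective _).mp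
        ((mvSES_shortExact R M (slitUp 1) (slitDown 1)).mono_δ 1 0 rfl (isZero_mvTwo_X₂_homology_one R M))
        (congrArg Subtype.val h),
      fun ⟨x, hx⟩ => by
        have hex := (mvSES_shortExact R M (slitUp 1) (slitDown 1)).homology_exact₁ 1 0 rfl
        rw [ShortComplex.moduleCat_exact_iff] at hex
        obtain ⟨y, hy⟩ := hex x hx
        exact ⟨y, Subtype.ext hy⟩⟩

/-- The open right half-plane. [folklore] -/
def halfPlanePos : Set (RVec 2) := {v | 0 < v 0}

/-- The open left half-plane. [folklore] -/
def halfPlaneNeg : Set (RVec 2) := {v | v 0 < 0}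

omit R M in
/-- The half-planes are path-connected (convex and nonempty). [folklore] -/
lemma isPathConnected_halfPlanePos : IsPathConnected halfPlanePos := by
  refine Convex.isPathConnected ?_ ⟨ptE, by simp [halfPlanePos, ptE]⟩
  exact convex_halfSpace_gt (LinearMap.proj 0).isLinear 0

omit R M in
/-- The half-planes are path-connected (convex and nonempty). [folklore] -/
lemma isPathConnected_halfPlaneNeg : IsPathConnected halfPlaneNeg := by
  refine Convex.isPathConnected ?_ ⟨ptW, by simp [halfPlaneNeg, ptW]⟩
  exact convex_halfSpace_lt (LinearMap.proj 0).isLinear 0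

omit R M in
/-- The half-planes lie in `A ∩ B`. [folklore] -/
lemma halfPlanePos_subset : halfPlanePos ⊆ slitUp 1 ∩ slitDown 1 := by
  rw [slitInter_one_eq]
  exact fun v (hv : 0 < v 0) => ne_of_gt hv

omit R M in
/-- The half-planes lie in `A ∩ B`. [folklore] -/
lemma halfPlaneNeg_subset : halfPlaneNeg ⊆ slitUp 1 ∩ slitDown 1 := by
  rw [slitInter_one_eq]
  exact fun v (hv : v 0 < 0) => ne_of_lt hv

/-- `ε` of the right-half-plane part of a `0`-chain is `epsPos` of the chain. [folklore] -/
lemma eps_filter_pos (c : CChain M (RVec 2) 0) :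
    CChain.eps R M (Finsupp.filter (fun ρ : SingularSimplex (RVec 2) 0 => 0 < ρ.pt 0) c) = epsPos R M c := by
  classical
  induction c using Finsupp.induction_linear with
  | zero => rw [Finsupp.filter_zero, map_zero, map_zero]
  | add f g hf hg => rw [Finsupp.filter_add, map_add, map_add, hf, hg]
  | single ρ m =>
    rw [epsPos_single]
    split_ifs with h
    · rw [Finsupp.filter_single_of_pos (fun σ : SingularSimplex (RVec 2) 0 => 0 < σ.pt 0) h, CChain.eps_single]
    · rw [Finsupp.filter_single_of_neg (fun σ : SingularSimplex (RVec 2) 0 => 0 < σ.pt 0) h, map_zero]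

/-- A `0`-chain of `A ∩ B ⊆ ℝ² ∖ 0` with `ε = 0` and `epsPos = 0` is a boundary in `A ∩ B`: split it
into its parts in the two half-planes, each of which is path-connected. [folklore] -/
lemma exists_bd_eq_of_eps_epsPos {z : CChain M (RVec 2) 0}
    (hz : z ∈ chainsIn R M (RVec 2) (slitUp 1 ∩ slitDown 1) 0) (hε : CChain.eps R M z = 0)
    (hε' : epsPos R M z = 0) :
    ∃ w ∈ chainsIn R M (RVec 2) (slitUp 1 ∩ slitDown 1) 1, csingularChainComplex.bd R 0 w = z := by
  classical
  set zp : CChain M (RVec 2) 0 := Finsupp.filter (fun ρ : SingularSimplex (RVec 2) 0 => 0 < ρ.pt 0) z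
    with hzp
  set zn : CChain M (RVec 2) 0 := Finsupp.filter (fun ρ : SingularSimplex (RVec 2) 0 => ¬ 0 < ρ.pt 0) z
    with hzn
  have hsum : zp + zn = z := Finsupp.filter_add_filter_not z _
  have hz' := (mem_chainsIn_zero_iff R M _ z).mp hz
  have hzpm : zp ∈ chainsIn R M (RVec 2) halfPlanePos 0 := by
    rw [mem_chainsIn_zero_iff]
    intro ρ hρ
    rw [hzp, Finsupp.support_filter, Finset.mem_filter] at hρ
    exact hρ.2
  have hznm : zn ∈ chainsIn R M (RVec 2) halfPlaneNeg 0 := by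
    rw [mem_chainsIn_zero_iff]
    intro ρ hρ
    rw [hzn, Finsupp.support_filter, Finset.mem_filter] at hρ
    have hne : ρ.pt 0 ≠ 0 := by
      have h := hz' ρ hρ.1
      rw [slitInter_one_eq] at h
      exact h
    exact lt_of_le_of_ne (not_lt.mp hρ.2) hne
  have hεp : CChain.eps R M zp = 0 := by rw [hzp, eps_filter_pos, hε']
  have hεn : CChain.eps R M zn = 0 := by
    have h := congrArg (CChain.eps R M) hsum
    rw [map_add, hεp, zero_add, hε] at h
    exact h
  obtain ⟨wp, hwp, hbdp⟩ := exists_bd_eq_of_eps_eq_zero R M isPathConnected_halfPlanePos hzpm hεp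
  obtain ⟨wn, hwn, hbdn⟩ := exists_bd_eq_of_eps_eq_zero R M isPathConnected_halfPlaneNeg hznm hεn
  refine ⟨wp + wn, Submodule.add_mem _ (chainsIn_mono R M halfPlanePos_subset 1 hwp)
    (chainsIn_mono R M halfPlaneNeg_subset 1 hwn), ?_⟩
  rw [map_add, hbdp, hbdn, hsum]

/-- `epsPos` restricted to the kernel is injective. [folklore] -/
lemma epsPosH_injOn_ker (x : (mvTwo R M).X₁.homology 0) (hx : x ∈ mvTwoKer R M)
    (h : epsPosH R M x = 0) : x = 0 := by
  obtain ⟨z, hz, rfl⟩ := homologyCls_surjective x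
  rw [cls_mem_mvTwoKer_iff] at hx
  rw [epsPosH_cls] at h
  have hzm : (z.1 : CChain M (RVec 2) 0) ∈ chainsIn R M (RVec 2) (slitUp 1 ∩ slitDown 1) 0 :=
    (mem_chainsInSub_iff R M _ 0 _).mp ((chainsInSub_inter R M (slitUp 1) (slitDown 1)).symm.le 0 z.2)
  obtain ⟨w, hw, hbd⟩ := exists_bd_eq_of_eps_epsPos R M hzm hx h
  rw [homologyCls_eq_zero_iff, exists_d_prev_eq_iff (ChainComplex.prev ℕ 0)]
  refine ⟨⟨w, (chainsInSub_inter R M (slitUp 1) (slitDown 1)).le 1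
    ((mem_chainsInSub_iff R M _ 1 _).mpr hw)⟩, Subtype.ext ?_⟩
  exact (toComplex_d_val R M _ 0 _).trans hbd

/-- The `0`-cycle `m [(1,0)] - m [(-1,0)]` of `C(A ∩ B)`. [folklore] -/
def genCycle (m : M) : (mvTwo R M).X₁.X 0 :=
  ⟨Finsupp.single (ofPoint ptE) m - Finsupp.single (ofPoint ptW) m,
    (chainsInSub_inter R M (slitUp 1) (slitDown 1)).le 0 ((mem_chainsInSub_iff R M _ 0 _).mpr
      (Submodule.sub_mem _
        (single_mem_chainsIn R M (by rw [range_ofPoint, Set.singleton_subset_iff]; exact ptE_mem.1) m)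
        (single_mem_chainsIn R M (by rw [range_ofPoint, Set.singleton_subset_iff]; exact ptE_mem.2) m)))⟩

/-- `ε (m [(1,0)] - m [(-1,0)]) = 0`. [folklore] -/
lemma eps_genCycle (m : M) : CChain.eps R M (genCycle R M m).1 = 0 := by
  simp [genCycle]

/-- `epsPos (m [(1,0)] - m [(-1,0)]) = m`. [folklore] -/
lemma epsPos_genCycle (m : M) : epsPos R M (genCycle R M m).1 = m := by
  change epsPos R M (Finsupp.single (ofPoint ptE) m - Finsupp.single (ofPoint ptW) m) = m
  rw [map_sub, epsPos_single, epsPos_single, pt_ofPoint, pt_ofPoint]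
  norm_num [ptE, ptW]

/-- **`ker (H₀(A ∩ B) → H₀(A) ⊕ H₀(B)) ≅ M`** for `ℝ² ∖ {0}`, via the half-plane count `epsPos`
(the kernel consists of the classes `a[p] + b[q]`, `p`, `q` in the two half-planes, with `a + b = 0`). [folklore] -/
def mvTwoKerEquiv : mvTwoKer R M ≃ₗ[R] M :=
  LinearEquiv.ofBijective ((epsPosH R M).domRestrict (mvTwoKer R M))
    ⟨fun x x' h => by
        rw [← sub_eq_zero] at h ⊢
        have h' : epsPosH R M (x.1 - x'.1) = 0 := by rw [map_sub]; exact h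
        exact Subtype.ext ((epsPosH_injOn_ker R M _ (Submodule.sub_mem _ x.2 x'.2) h').trans
          (Submodule.coe_zero (p := mvTwoKer R M)).symm),
      fun m => ⟨⟨homologyCls (genCycle R M m) (toComplex_d_zero_next R M _ _),
          (cls_mem_mvTwoKer_iff R M _ _).mpr (eps_genCycle R M m)⟩, by
        rw [LinearMap.domRestrict_apply, epsPosH_cls, epsPos_genCycle]⟩⟩

end PuncturedTwo

/-- **`H₁(ℝ² ∖ {0}; M) ≅ M`** (Hatcher 2002, Cor. 2.14 / Ex. 2.18 for `S¹ ≃ ℝ² ∖ 0`), by the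
Mayer–Vietoris sequence of the slit decomposition: `H₁(ℝ² ∖ 0) ≅ H₁(C(A) + C(B))` injects by `δ`
onto `ker (H₀(A ∩ B) → H₀(A) ⊕ H₀(B)) ≅ M`. [folklore] -/
def homologyPuncturedTwoIso : csingularHomology R M ↥(punctured 2) 1 ≅ ModuleCat.of R M :=
  (unionSlitIso R M 1 1).symm ≪≫ (mvUnionHomologyIso R M (isOpen_slitUp 1) (isOpen_slitDown 1) 1).symm ≪≫
    ((PuncturedTwo.mvTwoDeltaEquiv R M).trans (PuncturedTwo.mvTwoKerEquiv R M)).toModuleIso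

/-- **`Hₘ(ℝᵐ⁺¹ ∖ {0}; M) ≅ M` for `m ≥ 1`** (Hatcher 2002, Cor. 2.14 in the model `ℝᵐ⁺¹ ∖ 0 ≃ Sᵐ`),
by `puncturedSuccIso` down to `H₁(ℝ² ∖ 0)`. [folklore] -/
def homologyPuncturedIso : ∀ (m : ℕ), 1 ≤ m → (csingularHomology R M ↥(punctured (m + 1)) m ≅ ModuleCat.of R M)
  | 0, h => absurd h (by omega)
  | 1, _ => homologyPuncturedTwoIso R M
  | m + 2, _ => puncturedSuccIso R M (m + 2) (m + 1) (by omega) ≪≫ homologyPuncturedIso (m + 1) (by omega)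

end PuncturedTwo

/-! ### The homology of spheres (Hatcher Cor. 2.14) -/

section Spheres

variable (R : Type v) [CommRing R] (M : Type v) [AddCommGroup M] [Module R M]

/-- **`Hₙ(Sⁿ; M) ≅ M` for `n ≥ 1`** in the concrete model, `Sⁿ` the unit sphere of
`EuclideanSpace ℝ (Fin (n + 1))` (Hatcher 2002, Cor. 2.14). [cite: HatcherAT2002, Cor. 2.14] -/
def csingularHomologyUnitSphereIso (n : ℕ) (hn : 1 ≤ n) :
    csingularHomology R M ↥(unitSphere (n + 1)) n ≅ ModuleCat.of R M :=
  csingularHomology.isoOfHomotopyEquiv R M (sphereHomotopyEquivPunctured (n + 1)) n ≪≫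
    homologyPuncturedIso R M n hn

/-- **`Hₙ(Sⁿ; M) ≅ M` for `n ≥ 1`** for Mathlib's singular homology `Literature.AlgebraicTopology.SingularHomology.singularHomology`
(Hatcher 2002, Cor. 2.14). [cite: HatcherAT2002, Cor. 2.14] -/
def singularHomologyUnitSphereIso (n : ℕ) (hn : 1 ≤ n) :
    singularHomology R M ↥(unitSphere (n + 1)) n ≅ ModuleCat.of R M :=
  (csingularHomology.compIso R M _ n).symm ≪≫ csingularHomologyUnitSphereIso R M n hn

/-- **Discharge of the named fact `nonempty_singularHomology_sphere_iso`** (Hatcher 2002,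
Cor. 2.14): `Hₙ(Sⁿ; M) ≅ M` for `n ≥ 1`. [cite: HatcherAT2002, Cor. 2.14] -/
theorem nonempty_singularHomology_sphere_iso_holds : nonempty_singularHomology_sphere_iso R M :=
  fun {n} hn => ⟨singularHomologyUnitSphereIso R M n hn ≪≫ (ULift.moduleEquiv (R := R) (M := M)).symm.toModuleIso⟩

end Spheres



end Literature.AlgebraicTopology.SingularHomology

end
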